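import Summits.QuantumAdvantage.QuantumAdvantage.Theorems.CubicForrelationSignedExactCubicForrelationNotPrBPPStubNoTrapTemplateLemmas

/-!
# Crux `CubicForrelation.SignedExactCubicForrelationNotPrBPP` (stmt-QuantumAdvantage-13932), line `dual-pingpong-frame`:
# stub `stub_radicalGood` — radical directions are good

Support file (`--supports stmt-QuantumAdvantage-13932`). Write `D_u D_w b (x) = b x ⊕ b (x ⊕ u) ⊕ b (x ⊕ w) ⊕ b (x ⊕ u ⊕ w)`
for the second difference of an ARBITRARY Boolean function `b` on `𝔽₂ⁿ` (no degree hypothesis), and call a finset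
`V ∋ 0` closed under `⊕` with `|V|² = 2ⁿ` and `D_u D_w b ≡ 0` for `u, w ∈ V` an *M-subspace* of `b`
[Carlet2020, Prop. 54]. The registered stub: if `V ⊋ S` is an M-subspace through the `⊕`-closed `S ∋ 0`,
orthogonal to `U` (inner products spelled `(univ.filter fun i => sᵢ ∧ uᵢ).card.bodd`), and `v` is a RADICAL
direction (`D_x D_v b` is a constant function for every `x`) with `D_s D_v b ≡ 0` for `s ∈ S` and `v ⊥ U`, then some
M-subspace through `S` and `v` is orthogonal to `U`.

Proof. If `v ∈ V` take `V`. Otherwise let `c u := D_u D_v b (0)`; the cocycle law makes `c` additive, and `c = 0`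
on `S`. Pick an additive `ψ : V → 𝔽₂` with `ψ ≢ 0` on `V`, `ψ = 0` on `S` and `c = 0` on `V ∩ ker ψ`: `ψ = c` if
`c ≢ 0` on `V`, else `ψ = (· · w)` for a `w ∈ S^⊥ ∖ V^⊥` (which exists because `|S|·|S^⊥| = 2ⁿ = |V|·|V^⊥|` and
`|S| < |V|`). Then `V₀ = V ∩ ker ψ` has index `2` in `V` (translation by a `u₁` with `ψ u₁ = 1`), and
`V' = V₀ ∪ (V₀ ⊕ v)` is the required M-subspace: `|V'| = |V|`, and flatness follows from the four-term identity
`D_u D_{p ⊕ q} b (x) = D_u D_p b (x ⊕ q) ⊕ D_u D_q b (x)` together with `D_u D_v b ≡ c u = 0` on `V₀` and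
`D_v D_v b ≡ 0`.

* `RadicalGood.*` — the calculus of `D` (generic `D` with its defining equation `hD`, as in `NoTrap`), the index-2 count `card_ker_add_card_ker`, the separating vector `exists_sep`, the extension
  `extend_of_char`, and the generic-`D` form `radicalGood`;
* `stub_radicalGood` — verbatim the registered statement.

References: C. Carlet, *Boolean Functions for Cryptography and Coding Theory*, CUP 2021, Prop. 54 (M-subspaces,
second-order derivatives) and §2.2.2 (derivatives) [Carlet2020]; R. O'Donnell, *Analysis of Boolean Functions*,
CUP 2014, §3.3 (`|W|·|W^⊥| = 2ⁿ`) [ODonnell2014]. -/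

noncomputable section

set_option linter.dupNamespace false -- D-0017: single-problem summit ⇒ `QuantumAdvantage.QuantumAdvantage` by design

namespace Summit.QuantumAdvantage.QuantumAdvantage.Theorems.SignedExactCubicForrelationNotPrBPP

open Finset
open Literature.Computability.Complexity Literature.Computability.QuantumComplexity
open Literature.Computability.QuantumComplexity.BuzetChailloux (bxor zeroVec bxor_self bxor_comm
  bxor_zeroVec zeroVec_bxor bxor_bxor_cancel_left)
open PolarGeometry (bdot_comm bdot_bxor_left twist_eq_one_iff_bdot bxor_bxor_assoc)
open NoTrap (D_symm D_bxor_left)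

namespace RadicalGood

variable {n : ℕ}

/-! ### Calculus of second differences (no degree hypothesis) -/

/-- `D_v D_v f ≡ 0`. [folklore] -/
theorem D_self {f : (Fin n → Bool) → Bool}
    (D : (Fin n → Bool) → (Fin n → Bool) → (Fin n → Bool) → Bool)
    (hD : ∀ u v x, D u v x = (f x ^^ f (bxor x u) ^^ f (bxor x v) ^^ f (bxor x (bxor u v))))
    (v x : Fin n → Bool) : D v v x = false := by
  rw [hD, bxor_self, bxor_zeroVec]
  cases f x <;> cases f (bxor x v) <;> rfl

/-- The cocycle law in the second slot: `D_u D_{p ⊕ q} f (x) = D_u D_p f (x ⊕ q) ⊕ D_u D_q f (x)`. [folklore] -/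
theorem D_bxor_right {f : (Fin n → Bool) → Bool}
    (D : (Fin n → Bool) → (Fin n → Bool) → (Fin n → Bool) → Bool)
    (hD : ∀ u v x, D u v x = (f x ^^ f (bxor x u) ^^ f (bxor x v) ^^ f (bxor x (bxor u v))))
    (u p q x : Fin n → Bool) : D u (bxor p q) x = (D u p (bxor x q) ^^ D u q x) := by
  rw [D_symm D hD u (bxor p q) x, D_bxor_left D hD p q u x, D_symm D hD p u, D_symm D hD q u]

/-- If `D_u D_p f ≡ 0` and `D_u D_q f ≡ 0` then `D_u D_{p ⊕ q} f ≡ 0`. [folklore] -/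
theorem D_bxor_right_eq_false {f : (Fin n → Bool) → Bool}
    (D : (Fin n → Bool) → (Fin n → Bool) → (Fin n → Bool) → Bool)
    (hD : ∀ u v x, D u v x = (f x ^^ f (bxor x u) ^^ f (bxor x v) ^^ f (bxor x (bxor u v))))
    {u p q : Fin n → Bool} (hp : ∀ x, D u p x = false) (hq : ∀ x, D u q x = false) (x : Fin n → Bool) :
    D u (bxor p q) x = false := by
  rw [D_bxor_right D hD, hp, hq]
  decide

/-- A radical direction has constant second differences: if `D_x D_v f (z) = D_x D_v f (z ⊕ y)` for all `y, z`
then `D_x D_v f (z) = D_x D_v f (0)`. [folklore] -/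
theorem D_const_of_radical (D : (Fin n → Bool) → (Fin n → Bool) → (Fin n → Bool) → Bool)
    {v : Fin n → Bool} (hrad : ∀ x y z : Fin n → Bool, (D x v z ^^ D x v (bxor z y)) = false)
    (x z : Fin n → Bool) : D x v z = D x v zeroVec := by
  have h := hrad x z zeroVec
  rw [zeroVec_bxor] at h
  revert h
  cases D x v zeroVec <;> cases D x v z <;> decide

/-! ### Index-2 subgroups and separating vectors -/

/-- **Index two**: if `ψ` is additive on the `⊕`-closed finset `V` and `ψ u₁ = 1` for some `u₁ ∈ V`, then
`ker ψ` is exactly half of `V` (translation by `u₁` swaps `ker ψ` and its complement). [cite: ODonnell2014, §3.3] -/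
theorem card_ker_add_card_ker {V : Finset (Fin n → Bool)} (hVadd : ∀ x ∈ V, ∀ y ∈ V, bxor x y ∈ V)
    (ψ : (Fin n → Bool) → Bool) (hψ : ∀ x ∈ V, ∀ y ∈ V, ψ (bxor x y) = (ψ x ^^ ψ y))
    {u₁ : Fin n → Bool} (hu₁ : u₁ ∈ V) (hψu₁ : ψ u₁ = true) :
    (V.filter fun u => ψ u = false).card + (V.filter fun u => ψ u = false).card = V.card := by
  conv_rhs => rw [← card_filter_add_card_filter_not (s := V) (fun u => ψ u = false)]
  congr 1
  refine card_nbij' (fun u => bxor u₁ u) (fun u => bxor u₁ u) (fun u hu => ?_) (fun u hu => ?_)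
    (fun u _ => bxor_bxor_cancel_left u₁ u) (fun u _ => bxor_bxor_cancel_left u₁ u)
  · obtain ⟨huV, hψu⟩ := mem_filter.1 (mem_coe.1 hu)
    refine mem_coe.2 (mem_filter.2 ⟨hVadd u₁ hu₁ u huV, ?_⟩)
    rw [hψ u₁ hu₁ u huV, hψu, hψu₁]
    decide
  · obtain ⟨huV, hψu⟩ := mem_filter.1 (mem_coe.1 hu)
    refine mem_coe.2 (mem_filter.2 ⟨hVadd u₁ hu₁ u huV, ?_⟩)
    rw [hψ u₁ hu₁ u huV, hψu₁]
    revert hψu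
    cases ψ u <;> decide

/-- **Separating vector**: if `S ⊆ V` are `⊕`-closed finsets containing `0` with `|S| < |V|`, some `w` is
orthogonal to `S` but not to `V` (`|S|·|S^⊥| = 2ⁿ = |V|·|V^⊥|` forces `|S^⊥| > |V^⊥|`, so `S^⊥ ⊄ V^⊥`).
[cite: ODonnell2014, §3.3] -/
theorem exists_sep {S V : Finset (Fin n → Bool)} (hS0 : zeroVec ∈ S) (hSadd : ∀ x ∈ S, ∀ y ∈ S, bxor x y ∈ S)
    (hV0 : zeroVec ∈ V) (hVadd : ∀ x ∈ V, ∀ y ∈ V, bxor x y ∈ V) (hlt : S.card < V.card) :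
    ∃ w : Fin n → Bool, (∀ s ∈ S, (univ.filter fun i => s i && w i).card.bodd = false) ∧
      ∃ u₁ ∈ V, (univ.filter fun i => u₁ i && w i).card.bodd = true := by
  have h1 : S.card * (univ.filter fun y => ∀ x ∈ S, twist x y = 1).card = 2 ^ n := by
    exact_mod_cast DerivativeWalsh.card_mul_card_perp hS0 hSadd
  have h2 : V.card * (univ.filter fun y => ∀ x ∈ V, twist x y = 1).card = 2 ^ n := by
    exact_mod_cast DerivativeWalsh.card_mul_card_perp hV0 hVadd
  have hPV : 0 < (univ.filter fun y => ∀ x ∈ V, twist x y = 1).card :=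
    card_pos.2 ⟨zeroVec, (DerivativeWalsh.bxor_mem_perp V).1⟩
  have hlt' : (univ.filter fun y => ∀ x ∈ V, twist x y = 1).card <
      (univ.filter fun y => ∀ x ∈ S, twist x y = 1).card := by
    by_contra hle
    push Not at hle
    have key : S.card * (univ.filter fun y => ∀ x ∈ S, twist x y = 1).card <
        V.card * (univ.filter fun y => ∀ x ∈ V, twist x y = 1).card :=
      calc S.card * (univ.filter fun y => ∀ x ∈ S, twist x y = 1).card
          ≤ S.card * (univ.filter fun y => ∀ x ∈ V, twist x y = 1).card := Nat.mul_le_mul_left _ hle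
        _ < V.card * (univ.filter fun y => ∀ x ∈ V, twist x y = 1).card :=
          Nat.mul_lt_mul_of_lt_of_le hlt le_rfl hPV
    omega
  have hns : ¬ (univ.filter fun y => ∀ x ∈ S, twist x y = 1) ⊆ (univ.filter fun y => ∀ x ∈ V, twist x y = 1) :=
    fun h => absurd (card_le_card h) (not_le.2 hlt')
  obtain ⟨w, hwS, hwV⟩ := not_subset.1 hns
  refine ⟨w, fun s hs => (twist_eq_one_iff_bdot s w).1 ((mem_filter.1 hwS).2 s hs), ?_⟩
  have hwV' : ¬ ∀ x ∈ V, twist x w = 1 := fun h => hwV (mem_filter.2 ⟨mem_univ _, h⟩)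
  push Not at hwV'
  obtain ⟨u₁, hu₁, hne⟩ := hwV'
  refine ⟨u₁, hu₁, ?_⟩
  have h := (twist_eq_one_iff_bdot u₁ w).not.1 hne
  revert h
  cases (univ.filter fun i => u₁ i && w i).card.bodd <;> decide

/-! ### The extension `V' = V₀ ∪ (V₀ ⊕ v)` -/

/-- **Extension by a character**. Let `V ∌ v` be an M-subspace of `f` through `S`, orthogonal to `U`, `v ⊥ U`, and
let `ψ` be additive on `V` with `ψ ≢ 0` on `V`, `ψ = 0` on `S`, and `D_u D_v f ≡ 0` on `V₀ = V ∩ ker ψ`. Then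
`V' = V₀ ∪ (V₀ ⊕ v)` is an M-subspace through `S` and `v` orthogonal to `U` (index-2 count for `|V'| = |V|`; the
cocycle law for flatness). [cite: Carlet2020, Prop. 54] -/
theorem extend_of_char {f : (Fin n → Bool) → Bool}
    (D : (Fin n → Bool) → (Fin n → Bool) → (Fin n → Bool) → Bool)
    (hD : ∀ u v x, D u v x = (f x ^^ f (bxor x u) ^^ f (bxor x v) ^^ f (bxor x (bxor u v))))
    {S U V : Finset (Fin n → Bool)} {v : Fin n → Bool}
    (hV0 : zeroVec ∈ V) (hVadd : ∀ x ∈ V, ∀ y ∈ V, bxor x y ∈ V) (hVcard : ((V.card : ℝ)) ^ 2 = (2 : ℝ) ^ n)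
    (hVflat : ∀ u ∈ V, ∀ w ∈ V, ∀ x, D u w x = false)
    (hSV : S ⊆ V) (hVU : ∀ s ∈ V, ∀ u ∈ U, (univ.filter fun i => s i && u i).card.bodd = false)
    (hvV : v ∉ V) (hvU : ∀ u ∈ U, (univ.filter fun i => u i && v i).card.bodd = false)
    (ψ : (Fin n → Bool) → Bool) (hψ : ∀ x ∈ V, ∀ y ∈ V, ψ (bxor x y) = (ψ x ^^ ψ y))
    {u₁ : Fin n → Bool} (hu₁ : u₁ ∈ V) (hψu₁ : ψ u₁ = true) (hψS : ∀ s ∈ S, ψ s = false)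
    (hker : ∀ u ∈ V, ψ u = false → ∀ x, D u v x = false) :
    ∃ V' : Finset (Fin n → Bool), ((zeroVec ∈ V' ∧ ∀ x ∈ V', ∀ y ∈ V', bxor x y ∈ V') ∧
        (((V').card : ℝ) ^ 2 = (2 : ℝ) ^ n) ∧ ∀ u ∈ V', ∀ w ∈ V', ∀ x, D u w x = false) ∧
      S ⊆ V' ∧ v ∈ V' ∧ (∀ s ∈ V', ∀ u ∈ U, ((Finset.univ.filter fun i => s i && u i).card).bodd = false) := by
  set V₀ : Finset (Fin n → Bool) := V.filter fun u => ψ u = false with hV₀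
  have hV₀V : ∀ u ∈ V₀, u ∈ V := fun u hu => (mem_filter.1 hu).1
  have hV₀ψ : ∀ u ∈ V₀, ψ u = false := fun u hu => (mem_filter.1 hu).2
  have h00 : zeroVec ∈ V₀ := by
    refine mem_filter.2 ⟨hV0, ?_⟩
    have h := hψ _ hV0 _ hV0
    rw [zeroVec_bxor] at h
    revert h
    cases ψ zeroVec <;> decide
  have hadd0 : ∀ x ∈ V₀, ∀ y ∈ V₀, bxor x y ∈ V₀ := fun x hx y hy =>
    mem_filter.2 ⟨hVadd x (hV₀V x hx) y (hV₀V y hy), by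
      rw [hψ x (hV₀V x hx) y (hV₀V y hy), hV₀ψ x hx, hV₀ψ y hy]; decide⟩
  -- flatness pieces
  have hker0 : ∀ u ∈ V₀, ∀ x, D u v x = false := fun u hu => hker u (hV₀V u hu) (hV₀ψ u hu)
  have hflat0 : ∀ u ∈ V₀, ∀ w ∈ V₀, ∀ x, D u w x = false := fun u hu w hw =>
    hVflat u (hV₀V u hu) w (hV₀V w hw)
  refine ⟨V₀ ∪ V₀.image (fun u => bxor v u), ⟨⟨mem_union_left _ h00, ?_⟩, ?_, ?_⟩,
    fun s hs => mem_union_left _ (mem_filter.2 ⟨hSV hs, hψS s hs⟩),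
    mem_union_right _ (mem_image.2 ⟨zeroVec, h00, bxor_zeroVec v⟩), ?_⟩
  · -- `⊕`-closed
    intro x hx y hy
    rcases mem_union.1 hx with hx | hx <;> rcases mem_union.1 hy with hy | hy
    · exact mem_union_left _ (hadd0 x hx y hy)
    · obtain ⟨y₀, hy₀, rfl⟩ := mem_image.1 hy
      refine mem_union_right _ (mem_image.2 ⟨bxor x y₀, hadd0 x hx y₀ hy₀, ?_⟩)
      show bxor v (bxor x y₀) = bxor x (bxor v y₀)
      rw [bxor_bxor_assoc, bxor_bxor_assoc, bxor_comm v x]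
    · obtain ⟨x₀, hx₀, rfl⟩ := mem_image.1 hx
      exact mem_union_right _ (mem_image.2 ⟨bxor x₀ y, hadd0 x₀ hx₀ y hy, bxor_bxor_assoc v x₀ y⟩)
    · obtain ⟨x₀, hx₀, rfl⟩ := mem_image.1 hx
      obtain ⟨y₀, hy₀, rfl⟩ := mem_image.1 hy
      rw [bxor_bxor_assoc, bxor_comm (bxor v x₀) v, bxor_bxor_cancel_left]
      exact mem_union_left _ (hadd0 x₀ hx₀ y₀ hy₀)
  · -- `|V'| = |V|`
    have hdisj : Disjoint V₀ (V₀.image fun u => bxor v u) := by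
      refine disjoint_left.2 fun {a} ha hb => hvV ?_
      obtain ⟨a₀, ha₀, rfl⟩ := mem_image.1 hb
      have h := hVadd a₀ (hV₀V a₀ ha₀) _ (hV₀V _ ha)
      rwa [bxor_comm v a₀, bxor_bxor_cancel_left] at h
    have hinj : Function.Injective fun u : Fin n → Bool => bxor v u :=
      Function.Involutive.injective (bxor_bxor_cancel_left v)
    have hc : (V₀ ∪ V₀.image fun u => bxor v u).card = V.card := by
      rw [card_union_of_disjoint hdisj, card_image_of_injective _ hinj]
      exact card_ker_add_card_ker hVadd ψ hψ hu₁ hψu₁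
    rw [hc]
    exact hVcard
  · -- flatness
    have hW : ∀ u ∈ V₀ ∪ V₀.image (fun u => bxor v u), ∀ x, D u v x = false := by
      intro u hu x
      rcases mem_union.1 hu with hu | hu
      · exact hker0 u hu x
      · obtain ⟨u₀, hu₀, rfl⟩ := mem_image.1 hu
        rw [D_bxor_left D hD, D_self D hD, hker0 u₀ hu₀]
        decide
    have hW₀ : ∀ u ∈ V₀ ∪ V₀.image (fun u => bxor v u), ∀ w ∈ V₀, ∀ x, D u w x = false := by
      intro u hu w hw x
      rcases mem_union.1 hu with hu | hu
      · exact hflat0 u hu w hw x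
      · obtain ⟨u₀, hu₀, rfl⟩ := mem_image.1 hu
        rw [D_bxor_left D hD, D_symm D hD v w, hker0 w hw, hflat0 u₀ hu₀ w hw]
        decide
    intro u hu w hw x
    rcases mem_union.1 hw with hw | hw
    · exact hW₀ u hu w hw x
    · obtain ⟨w₀, hw₀, rfl⟩ := mem_image.1 hw
      exact D_bxor_right_eq_false D hD (hW u hu) (hW₀ u hu w₀ hw₀) x
  · -- `V' ⊥ U`
    intro s hs u hu
    rcases mem_union.1 hs with hs | hs
    · exact hVU s (hV₀V s hs) u hu
    · obtain ⟨s₀, hs₀, rfl⟩ := mem_image.1 hs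
      rw [bdot_bxor_left, bdot_comm v u, hvU u hu, hVU s₀ (hV₀V s₀ hs₀) u hu]
      decide

/-- **Radical directions are good** (generic-`D` form of the registered stub). [cite: Carlet2020, Prop. 54] -/
theorem radicalGood {f : (Fin n → Bool) → Bool}
    (D : (Fin n → Bool) → (Fin n → Bool) → (Fin n → Bool) → Bool)
    (hD : ∀ u v x, D u v x = (f x ^^ f (bxor x u) ^^ f (bxor x v) ^^ f (bxor x (bxor u v))))
    {S U V : Finset (Fin n → Bool)} {v : Fin n → Bool}
    (hS0 : zeroVec ∈ S) (hSadd : ∀ x ∈ S, ∀ y ∈ S, bxor x y ∈ S)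
    (hV0 : zeroVec ∈ V) (hVadd : ∀ x ∈ V, ∀ y ∈ V, bxor x y ∈ V) (hVcard : ((V.card : ℝ)) ^ 2 = (2 : ℝ) ^ n)
    (hVflat : ∀ u ∈ V, ∀ w ∈ V, ∀ x, D u w x = false)
    (hSV : S ⊆ V) (hVU : ∀ s ∈ V, ∀ u ∈ U, (univ.filter fun i => s i && u i).card.bodd = false)
    (hlt : S.card < V.card)
    (hrad : ∀ x y z : Fin n → Bool, (D x v z ^^ D x v (bxor z y)) = false)
    (hZ : ∀ s ∈ S, ∀ x, D s v x = false)
    (hvU : ∀ u ∈ U, (univ.filter fun i => u i && v i).card.bodd = false) :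
    ∃ V' : Finset (Fin n → Bool), ((zeroVec ∈ V' ∧ ∀ x ∈ V', ∀ y ∈ V', bxor x y ∈ V') ∧
        (((V').card : ℝ) ^ 2 = (2 : ℝ) ^ n) ∧ ∀ u ∈ V', ∀ w ∈ V', ∀ x, D u w x = false) ∧
      S ⊆ V' ∧ v ∈ V' ∧ (∀ s ∈ V', ∀ u ∈ U, ((Finset.univ.filter fun i => s i && u i).card).bodd = false) := by
  by_cases hvV : v ∈ V
  · exact ⟨V, ⟨⟨hV0, hVadd⟩, hVcard, hVflat⟩, hSV, hvV, hVU⟩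
  -- `c u := D_u D_v f (0)`, the constant value of `D_u D_v f`
  have hconst : ∀ u x, D u v x = D u v zeroVec := D_const_of_radical D hrad
  have hcadd : ∀ u u', D (bxor u u') v zeroVec = (D u v zeroVec ^^ D u' v zeroVec) := fun u u' => by
    rw [D_bxor_left D hD, zeroVec_bxor, hconst u u']
  have hker : ∀ u ∈ V, D u v zeroVec = false → ∀ x, D u v x = false := fun u _ hc x => (hconst u x).trans hc
  have hcS : ∀ s ∈ S, D s v zeroVec = false := fun s hs => hZ s hs zeroVec
  by_cases hA : ∃ u₁ ∈ V, D u₁ v zeroVec = true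
  · obtain ⟨u₁, hu₁, hc1⟩ := hA
    exact extend_of_char D hD hV0 hVadd hVcard hVflat hSV hVU hvV hvU (fun u => D u v zeroVec)
      (fun x _ y _ => hcadd x y) hu₁ hc1 hcS hker
  · have hA' : ∀ u ∈ V, D u v zeroVec = false := fun u hu => Bool.eq_false_iff.2 fun h => hA ⟨u, hu, h⟩
    obtain ⟨w, hwS, u₁, hu₁, hwu₁⟩ := exists_sep hS0 hSadd hV0 hVadd hlt
    exact extend_of_char D hD hV0 hVadd hVcard hVflat hSV hVU hvV hvU
      (fun u => (univ.filter fun i => u i && w i).card.bodd) (fun x _ y _ => bdot_bxor_left x y w) hu₁ hwu₁ hwS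
      (fun u hu _ => hker u hu (hA' u hu))

end RadicalGood

/-- **Radical directions are good — for EVERY Boolean function `b`** (stub `stub_radicalGood` of line
`dual-pingpong-frame`, crux stmt-QuantumAdvantage-13932). If `V` is an M-subspace of `b` through `S`, orthogonal to
`U`, with `S ⊊ V`, and `v` is a RADICAL direction of `b` (`D_x D_v b` constant for every `x`) with `D_s D_v b ≡ 0`
for `s ∈ S` and `v ⊥ U`, then some M-subspace through `S` and `v` is orthogonal to `U`: `V` itself if `v ∈ V`;
otherwise `V₀ ∪ (V₀ ⊕ v)` for an index-2 subgroup `V₀ ⊇ S` of `V` on which the constants `c(u) = D_u D_v b` vanish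
(`V₀ = V ∩ ker c` if `c ≢ 0` on `V`, else `V₀` cut out by a `w ∈ S^⊥ ∖ V^⊥`). [cite: Carlet2020, Prop. 54] -/
theorem stub_radicalGood :
    ∀ (n : ℕ) (b : (Fin n → Bool) → Bool) (S U V : Finset (Fin n → Bool)) (v : Fin n → Bool),
      (zeroVec ∈ S ∧ ∀ x ∈ S, ∀ y ∈ S, bxor x y ∈ S) →
      ((zeroVec ∈ V ∧ ∀ x ∈ V, ∀ y ∈ V, bxor x y ∈ V) ∧ (((V).card : ℝ) ^ 2 = (2 : ℝ) ^ n) ∧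
        ∀ u ∈ V, ∀ w ∈ V, ∀ x, (b x ^^ b (bxor x u) ^^ b (bxor x w) ^^ b (bxor x (bxor u w))) = false) →
      S ⊆ V → (∀ s ∈ V, ∀ u ∈ U, ((Finset.univ.filter fun i => s i && u i).card).bodd = false) → S.card < V.card →
      (∀ x y z : Fin n → Bool, ((b z ^^ b (bxor z x) ^^ b (bxor z v) ^^ b (bxor z (bxor x v))) ^^
          (b (bxor z y) ^^ b (bxor (bxor z y) x) ^^ b (bxor (bxor z y) v) ^^ b (bxor (bxor z y) (bxor x v)))) = false) →
      (∀ s ∈ S, ∀ x, (b x ^^ b (bxor x s) ^^ b (bxor x v) ^^ b (bxor x (bxor s v))) = false) →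
      (∀ u ∈ U, ((Finset.univ.filter fun i => u i && v i).card).bodd = false) →
      ∃ V' : Finset (Fin n → Bool), ((zeroVec ∈ V' ∧ ∀ x ∈ V', ∀ y ∈ V', bxor x y ∈ V') ∧ (((V').card : ℝ) ^ 2 = (2 : ℝ) ^ n) ∧
          ∀ u ∈ V', ∀ w ∈ V', ∀ x, (b x ^^ b (bxor x u) ^^ b (bxor x w) ^^ b (bxor x (bxor u w))) = false) ∧
        S ⊆ V' ∧ v ∈ V' ∧ (∀ s ∈ V', ∀ u ∈ U, ((Finset.univ.filter fun i => s i && u i).card).bodd = false) := by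
  intro n b S U V v hS hV hSV hVU hlt hrad hZ hvU
  exact RadicalGood.radicalGood
    (fun u w x => (b x ^^ b (bxor x u) ^^ b (bxor x w) ^^ b (bxor x (bxor u w)))) (fun _ _ _ => rfl)
    hS.1 hS.2 hV.1.1 hV.1.2 hV.2.1 hV.2.2 hSV hVU hlt hrad hZ hvU

end Summit.QuantumAdvantage.QuantumAdvantage.Theorems.SignedExactCubicForrelationNotPrBPP

end
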